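import Mathlib
import Summits.AtomisticToContinuum.HydrodynamicLimit.Theorems.JaynesSqueezeEntropicWeakStrongHSCoercive
import HarnessLib

/-!
# `EntropicWeakStrongHS` (stmt-AtomisticToContinuum-13461), pointwise II: coercivity constants

On `[0, t] × 𝕋³ × K` (`t < T`, `K` compact inside the positivity/low-packing region) the
relative entropy density `H = h(V) - h(U) - λ·(V - U)` of the hard-sphere entropy dominates the
squared primitive increments, `H ≥ c₀ (a² + |b|² + c²)`, and the squared conservative distance
is dominated by them, `|V - U|² ≤ C' (a² + |b|² + c²)` (uniform bounds of the classical
solution on the compact slab and of the comparison states on `K`, the quadratic lower bounds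
for `klFun` and `z - 1 - log z`, and convexity of `y ↦ yF(yσ³)`).
-/

noncomputable section

open Set Filter MeasureTheory Function InformationTheory
open scoped Topology ContDiff

namespace Summit.AtomisticToContinuum.HydrodynamicLimit.Theorems.EntropicWeakStrong

open Literature.MathematicalPhysics.KineticTheory Literature.Analysis.FunctionSpaces

/-- In the positivity region the kinetic temperature is positive. -/
theorem thetaOf_pos (θo : (ℝ × V3 × ℝ) → ℝ)
    (hθo : θo = fun U => 2 / 3 * (U.2.2 / U.1 - ‖U.2.1‖ ^ 2 / (2 * U.1 ^ 2)))
    {V : ℝ × V3 × ℝ} (hV1 : 0 < V.1) (hV : ‖V.2.1‖ ^ 2 < 2 * V.1 * V.2.2) : 0 < θo V := by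
  subst hθo
  have h1 : ‖V.2.1‖ ^ 2 / (2 * V.1 ^ 2) < V.2.2 / V.1 := by
    rw [div_lt_div_iff₀ (by positivity) hV1]
    nlinarith
  simp only
  linarith

/-- Elementary bound for the energy increment. -/
theorem abs_energy_sub_le {r ρ ϑ θ wn un bn a c L : ℝ} (hρ : |ρ| ≤ L)
    (hϑ : |ϑ| ≤ L) (hwn : 0 ≤ wn) (hun : 0 ≤ un) (hwnL : wn ≤ L) (hunL : un ≤ L) (hbn : 0 ≤ bn)
    (hdiff : |wn - un| ≤ bn) (ha : a = r - ρ) (hc : c = ϑ - θ) (hL : 1 ≤ L) :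
    |r * (wn ^ 2 / 2 + 3 / 2 * ϑ) - ρ * (un ^ 2 / 2 + 3 / 2 * θ)| ≤
      4 * L ^ 2 * (|a| + bn + |c|) := by
  have hsplit : r * (wn ^ 2 / 2 + 3 / 2 * ϑ) - ρ * (un ^ 2 / 2 + 3 / 2 * θ) =
      a * (wn ^ 2 / 2 + 3 / 2 * ϑ) + ρ * ((wn - un) * (wn + un) / 2 + 3 / 2 * c) := by
    rw [ha, hc]; ring
  rw [hsplit]
  have hr' : |ρ| ≤ L := hρ
  have h1 : |a * (wn ^ 2 / 2 + 3 / 2 * ϑ)| ≤ |a| * (2 * L ^ 2) := by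
    rw [abs_mul]
    refine mul_le_mul_of_nonneg_left ?_ (abs_nonneg _)
    have : |wn ^ 2 / 2 + 3 / 2 * ϑ| ≤ wn ^ 2 / 2 + 3 / 2 * |ϑ| := by
      calc |wn ^ 2 / 2 + 3 / 2 * ϑ| ≤ |wn ^ 2 / 2| + |3 / 2 * ϑ| := abs_add_le _ _
        _ = wn ^ 2 / 2 + 3 / 2 * |ϑ| := by
          rw [abs_of_nonneg (by positivity), abs_mul, abs_of_nonneg (by norm_num : (0:ℝ) ≤ 3 / 2)]
    nlinarith [abs_nonneg ϑ]
  have h2 : |ρ * ((wn - un) * (wn + un) / 2 + 3 / 2 * c)| ≤ L * (bn * L + 3 / 2 * |c|) := by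
    rw [abs_mul]
    refine mul_le_mul hr' ?_ (abs_nonneg _) (by linarith)
    calc |(wn - un) * (wn + un) / 2 + 3 / 2 * c|
        ≤ |(wn - un) * (wn + un) / 2| + |3 / 2 * c| := abs_add_le _ _
      _ ≤ bn * L + 3 / 2 * |c| := by
        refine add_le_add ?_ ?_
        · rw [abs_div, abs_mul, abs_of_nonneg (by linarith : (0:ℝ) ≤ wn + un), abs_two]
          nlinarith [abs_nonneg (wn - un)]
        · rw [abs_mul, abs_of_nonneg (by norm_num : (0:ℝ) ≤ 3 / 2)]
  have k1 : 0 ≤ |a| := abs_nonneg a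
  have k3 : 0 ≤ |c| := abs_nonneg c
  have kL : L ≤ L ^ 2 := by nlinarith
  have t1 : |a| * (2 * L ^ 2) ≤ 4 * L ^ 2 * |a| := by nlinarith [sq_nonneg L]
  have t2 : L * (bn * L) ≤ 4 * L ^ 2 * bn := by nlinarith [sq_nonneg L]
  have t3 : L * (3 / 2 * |c|) ≤ 4 * L ^ 2 * |c| := by
    nlinarith [mul_le_mul_of_nonneg_right kL k3]
  calc |a * (wn ^ 2 / 2 + 3 / 2 * ϑ) + ρ * ((wn - un) * (wn + un) / 2 + 3 / 2 * c)|
      ≤ |a| * (2 * L ^ 2) + L * (bn * L + 3 / 2 * |c|) := (abs_add_le _ _).trans (add_le_add h1 h2)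
    _ ≤ 4 * L ^ 2 * (|a| + bn + |c|) := by linarith

/-- Thermal term: `3/2 r θ φ(ϑ/θ) ≥ κ₂ (ϑ - θ)²` with `κ₂ = 3 rmin/(4M₂²θmax + 1)`. -/
theorem thermal_lower {r θ ϑ rmin θmin θmax ϑmax M₂ : ℝ} (hr : rmin ≤ r) (hrmin : 0 < rmin)
    (hθ0 : 0 < θ) (hθmin : θmin ≤ θ) (hθmin0 : 0 < θmin) (hθle : θ ≤ θmax) (hϑ0 : 0 < ϑ)
    (hϑle : ϑ ≤ ϑmax) (hϑmax0 : 0 ≤ ϑmax) (hM₂1 : 1 ≤ M₂) (hM₂ : ϑmax / θmin ≤ M₂) :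
    3 * rmin / (4 * M₂ ^ 2 * θmax + 1) * (ϑ - θ) ^ 2 ≤
      3 / 2 * r * θ * ((ϑ / θ - 1) - Real.log (ϑ / θ)) := by
  have hr0 : 0 < r := hrmin.trans_le hr
  have hz : 0 < ϑ / θ := div_pos hϑ0 hθ0
  have hzM : ϑ / θ ≤ M₂ := by
    refine le_trans ?_ hM₂
    calc ϑ / θ ≤ ϑmax / θ := div_le_div_of_nonneg_right hϑle hθ0.le
      _ ≤ ϑmax / θmin := div_le_div_of_nonneg_left hϑmax0 hθmin0 hθmin
  have hlb := sub_one_sub_log_ge_sq hz hzM hM₂1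
  have hceq : (ϑ / θ - 1) ^ 2 / (2 * M₂ ^ 2) = (ϑ - θ) ^ 2 / (2 * M₂ ^ 2 * θ ^ 2) := by
    field_simp
  rw [hceq] at hlb
  have hθmax0 : 0 < θmax := hθ0.trans_le hθle
  have h1 : 3 / 2 * r * θ * ((ϑ - θ) ^ 2 / (2 * M₂ ^ 2 * θ ^ 2)) = 3 * r * (ϑ - θ) ^ 2 / (4 * M₂ ^ 2 * θ) := by
    field_simp
    ring
  have h2 : 3 * rmin / (4 * M₂ ^ 2 * θmax + 1) * (ϑ - θ) ^ 2 ≤ 3 * r * (ϑ - θ) ^ 2 / (4 * M₂ ^ 2 * θ) := by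
    rw [div_mul_eq_mul_div, div_le_div_iff₀ (by positivity) (by positivity)]
    have hden : 4 * M₂ ^ 2 * θ ≤ 4 * M₂ ^ 2 * θmax + 1 := by
      have := mul_le_mul_of_nonneg_left hθle (show (0:ℝ) ≤ 4 * M₂ ^ 2 by positivity)
      linarith
    have hc2 : 0 ≤ (ϑ - θ) ^ 2 := sq_nonneg _
    calc 3 * rmin * (ϑ - θ) ^ 2 * (4 * M₂ ^ 2 * θ)
        ≤ 3 * r * (ϑ - θ) ^ 2 * (4 * M₂ ^ 2 * θ) := by gcongr
      _ ≤ 3 * r * (ϑ - θ) ^ 2 * (4 * M₂ ^ 2 * θmax + 1) := by gcongr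
  have h3 : 3 / 2 * r * θ * ((ϑ - θ) ^ 2 / (2 * M₂ ^ 2 * θ ^ 2)) ≤
      3 / 2 * r * θ * ((ϑ / θ - 1) - Real.log (ϑ / θ)) :=
    mul_le_mul_of_nonneg_left hlb (by nlinarith)
  linarith

/-- Density term: `θρ klFun(r/ρ) ≥ κ₃ (r - ρ)²` with `κ₃ = θmin/(2M₁ρmax + 1)`. -/
theorem density_lower {r ρ θ rmax ρmin ρmax θmin M₁ : ℝ} (hr0 : 0 < r) (hrle : r ≤ rmax)
    (hrmax0 : 0 ≤ rmax) (hρ0 : 0 < ρ) (hρmin : ρmin ≤ ρ) (hρmin0 : 0 < ρmin) (hρle : ρ ≤ ρmax)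
    (hθ0 : 0 < θ) (hθmin : θmin ≤ θ) (hM₁1 : 1 ≤ M₁) (hM₁ : rmax / ρmin ≤ M₁) :
    θmin / (2 * M₁ * ρmax + 1) * (r - ρ) ^ 2 ≤ θ * ρ * klFun (r / ρ) := by
  have hz : 0 < r / ρ := div_pos hr0 hρ0
  have hzM : r / ρ ≤ M₁ := by
    refine le_trans ?_ hM₁
    calc r / ρ ≤ rmax / ρ := div_le_div_of_nonneg_right hrle hρ0.le
      _ ≤ rmax / ρmin := div_le_div_of_nonneg_left hrmax0 hρmin0 hρmin
  have hlb := klFun_ge_sq hz hzM hM₁1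
  have haeq : (r / ρ - 1) ^ 2 / (2 * M₁) = (r - ρ) ^ 2 / (2 * M₁ * ρ ^ 2) := by
    field_simp
  rw [haeq] at hlb
  have hM₁0 : 0 < M₁ := by linarith
  have hρmax0 : 0 < ρmax := hρ0.trans_le hρle
  have h1 : θ * ρ * ((r - ρ) ^ 2 / (2 * M₁ * ρ ^ 2)) = θ * (r - ρ) ^ 2 / (2 * M₁ * ρ) := by
    field_simp
  have h2 : θmin / (2 * M₁ * ρmax + 1) * (r - ρ) ^ 2 ≤ θ * (r - ρ) ^ 2 / (2 * M₁ * ρ) := by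
    rw [div_mul_eq_mul_div, div_le_div_iff₀ (by positivity) (by positivity)]
    have hden : 2 * M₁ * ρ ≤ 2 * M₁ * ρmax + 1 := by
      have := mul_le_mul_of_nonneg_left hρle (show (0:ℝ) ≤ 2 * M₁ by positivity)
      linarith
    calc θmin * (r - ρ) ^ 2 * (2 * M₁ * ρ) ≤ θ * (r - ρ) ^ 2 * (2 * M₁ * ρ) := by gcongr
      _ ≤ θ * (r - ρ) ^ 2 * (2 * M₁ * ρmax + 1) := by gcongr
  have h3 : θ * ρ * ((r - ρ) ^ 2 / (2 * M₁ * ρ ^ 2)) ≤ θ * ρ * klFun (r / ρ) :=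
    mul_le_mul_of_nonneg_left hlb (by positivity)
  linarith

/-- Momentum increment: `‖r•w - ρ•u‖² ≤ 2L²(|w - u|² + (r - ρ)²)` when `|r|, |u| ≤ L`. -/
theorem momentum_sq_le {r ρ L : ℝ} {w u : V3} (hr : |r| ≤ L) (hu : ‖u‖ ≤ L) :
    ‖r • w - ρ • u‖ ^ 2 ≤ 2 * L ^ 2 * ‖w - u‖ ^ 2 + 2 * L ^ 2 * (r - ρ) ^ 2 := by
  have hsplit : r • w - ρ • u = r • (w - u) + (r - ρ) • u := by
    rw [smul_sub, sub_smul]; abel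
  have hm : ‖r • w - ρ • u‖ ≤ L * ‖w - u‖ + L * |r - ρ| := by
    rw [hsplit]
    calc ‖r • (w - u) + (r - ρ) • u‖ ≤ ‖r • (w - u)‖ + ‖(r - ρ) • u‖ := norm_add_le _ _
      _ = |r| * ‖w - u‖ + |r - ρ| * ‖u‖ := by rw [norm_smul, norm_smul, Real.norm_eq_abs, Real.norm_eq_abs]
      _ ≤ L * ‖w - u‖ + L * |r - ρ| := by
        have h1 := mul_le_mul_of_nonneg_right hr (norm_nonneg (w - u))
        have h2 := mul_le_mul_of_nonneg_left hu (abs_nonneg (r - ρ))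
        linarith
  have h0 : 0 ≤ ‖r • w - ρ • u‖ := norm_nonneg _
  nlinarith [hm, sq_nonneg (L * ‖w - u‖ - L * |r - ρ|), sq_abs (r - ρ), abs_nonneg (r - ρ),
    norm_nonneg (w - u)]

/-- Squaring the energy bound. -/
theorem energy_sq_le {e a bn c L : ℝ} (he : |e| ≤ 4 * L ^ 2 * (|a| + bn + |c|)) :
    e ^ 2 ≤ 48 * L ^ 4 * (a ^ 2 + bn ^ 2 + c ^ 2) := by
  have h0 := abs_nonneg e
  have hsq := pow_le_pow_left₀ h0 he 2
  rw [sq_abs] at hsq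
  refine hsq.trans ?_
  have h3 : (|a| + bn + |c|) ^ 2 ≤ 3 * (a ^ 2 + bn ^ 2 + c ^ 2) := by
    nlinarith [sq_nonneg (|a| - bn), sq_nonneg (bn - |c|), sq_nonneg (|a| - |c|), sq_abs a, sq_abs c]
  nlinarith [h3, sq_nonneg (4 * L ^ 2)]

section Solution

variable {σ T η₀ : ℝ} {F : ℝ → ℝ} {ρ θ : ℝ → T3 → ℝ} {u : ℝ → T3 → V3}

/-- **Coercivity constants.** See the module docstring. -/
theorem coercive_constants (hE : IsHardSphereEulerSolution σ T ρ u θ) (hσ : 0 < σ)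
    (hFa : AnalyticOnNhd ℝ F (Ioo (-η₀) η₀)) (hF : EqOn hsExcessFreeEnergy F (Ico 0 η₀))
    (hconv : ∀ η ∈ Ico 0 η₀, 0 ≤ 2 * deriv F η + η * deriv (deriv F) η)
    (hpack : ∀ t ∈ Ico 0 T, ∀ x, ρ t x * σ ^ 3 < η₀)
    (θo : (ℝ × V3 × ℝ) → ℝ)
    (hθo : θo = fun U => 2 / 3 * (U.2.2 / U.1 - ‖U.2.1‖ ^ 2 / (2 * U.1 ^ 2)))
    (h : (ℝ × V3 × ℝ) → ℝ)
    (hh : h = fun U => -(U.1 * (3 / 2 * Real.log (θo U) - Real.log U.1 -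
      hsExcessFreeEnergy (U.1 * σ ^ 3))))
    (pair : (ℝ × V3 × ℝ) → (ℝ × V3 × ℝ) → ℝ)
    (hpair : pair = fun L U => L.1 * U.1 + (∑ j, L.2.1 j * U.2.1 j) + L.2.2 * U.2.2)
    {t : ℝ} (ht : t ∈ Ico 0 T) {K : Set (ℝ × V3 × ℝ)} (hK : IsCompact K)
    (hKΩ : K ⊆ {U : ℝ × V3 × ℝ | 0 < U.1 ∧ U.1 * σ ^ 3 < η₀ ∧ ‖U.2.1‖ ^ 2 < 2 * U.1 * U.2.2}) :
    ∃ c₀, 0 < c₀ ∧ ∃ C', 0 ≤ C' ∧ ∀ τ ∈ Icc 0 t, ∀ x, ∀ V ∈ K,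
      c₀ * ((V.1 - ρ τ x) ^ 2 + ‖V.1⁻¹ • V.2.1 - u τ x‖ ^ 2 + (θo V - θ τ x) ^ 2) ≤
        h V - h (ρ τ x, ρ τ x • u τ x, totalEnergyDensity (ρ τ x) (u τ x) (θ τ x)) -
          pair ((-(3 / 2 * Real.log (θ τ x) - Real.log (ρ τ x) - hsExcessFreeEnergy (ρ τ x * σ ^ 3)) +
            5 / 2 - ‖u τ x‖ ^ 2 / (2 * θ τ x) +
            ρ τ x * σ ^ 3 * deriv hsExcessFreeEnergy (ρ τ x * σ ^ 3) : ℝ),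
            (θ τ x)⁻¹ • u τ x, -(θ τ x)⁻¹)
            (V - (ρ τ x, ρ τ x • u τ x, totalEnergyDensity (ρ τ x) (u τ x) (θ τ x))) ∧
      (V.1 - ρ τ x) ^ 2 + ‖V.2.1 - ρ τ x • u τ x‖ ^ 2 +
          (V.2.2 - totalEnergyDensity (ρ τ x) (u τ x) (θ τ x)) ^ 2 ≤
        C' * ((V.1 - ρ τ x) ^ 2 + ‖V.1⁻¹ • V.2.1 - u τ x‖ ^ 2 + (θo V - θ τ x) ^ 2) := by
  have htT : Icc 0 t ⊆ Ico 0 T := Icc_subset_Ico_right ht.2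
  -- bounds of the classical solution on the slab
  obtain ⟨ρmin, hρmin0, hρmin⟩ := HsEulerCalc.exists_pos_le_of_isSmoothSpaceTimeOn hE.smooth_density
    hE.density_pos ht.2
  obtain ⟨θmin, hθmin0, hθmin⟩ := HsEulerCalc.exists_pos_le_of_isSmoothSpaceTimeOn hE.smooth_temperature
    hE.temperature_pos ht.2
  obtain ⟨ρmax, hρmax0, hρmax⟩ := HsEulerCalc.exists_abs_le_of_isSmoothSpaceTimeOn hE.smooth_density ht.2
  obtain ⟨θmax, hθmax0, hθmax⟩ := HsEulerCalc.exists_abs_le_of_isSmoothSpaceTimeOn hE.smooth_temperature ht.2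
  obtain ⟨umax₀, humax₀⟩ := hE.smooth_velocity.exists_norm_le_of_isCompact isCompact_Icc htT
  set umax := max umax₀ 0 with humax_def
  have humax : ∀ τ ∈ Icc 0 t, ∀ x, ‖u τ x‖ ≤ umax := fun τ hτ x => (humax₀ τ hτ x).trans (le_max_left _ _)
  have humax0 : 0 ≤ umax := le_max_right _ _
  -- bounds of the comparison states on `K`
  have hK1 : ∀ V ∈ K, V.1 ≠ 0 := fun V hV => (hKΩ hV).1.ne'
  obtain ⟨rmin, hrmin0, hrmin⟩ := exists_pos_lower_bound hK continuousOn_fst fun V hV => (hKΩ hV).1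
  obtain ⟨rmax, hrmax0, hrmax⟩ := exists_upper_bound hK continuousOn_fst
  have hθoc : ContinuousOn θo K := continuousOn_thetaOf θo hθo hK1
  have hθopos : ∀ V ∈ K, 0 < θo V := fun V hV => thetaOf_pos θo hθo (hKΩ hV).1 (hKΩ hV).2.2
  obtain ⟨ϑmin, hϑmin0, hϑmin⟩ := exists_pos_lower_bound hK hθoc hθopos
  obtain ⟨ϑmax, hϑmax0, hϑmax⟩ := exists_upper_bound hK hθoc
  have hwc : ContinuousOn (fun V : ℝ × V3 × ℝ => ‖V.1⁻¹ • V.2.1‖) K :=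
    ((continuousOn_fst.inv₀ hK1).smul continuousOn_snd.fst).norm
  obtain ⟨wmax, hwmax0, hwmax⟩ := exists_upper_bound hK hwc
  -- the constants (kept opaque)
  obtain ⟨M₁, hM₁1, hM₁⟩ : ∃ M₁ : ℝ, 1 ≤ M₁ ∧ rmax / ρmin ≤ M₁ :=
    ⟨max 1 (rmax / ρmin), le_max_left _ _, le_max_right _ _⟩
  obtain ⟨M₂, hM₂1, hM₂⟩ : ∃ M₂ : ℝ, 1 ≤ M₂ ∧ ϑmax / θmin ≤ M₂ :=
    ⟨max 1 (ϑmax / θmin), le_max_left _ _, le_max_right _ _⟩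
  obtain ⟨κ, hκ0, k1, k2, k3⟩ : ∃ κ : ℝ, 0 < κ ∧ κ ≤ rmin / 2 ∧
      κ ≤ 3 * rmin / (4 * M₂ ^ 2 * θmax + 1) ∧ κ ≤ θmin / (2 * M₁ * ρmax + 1) := by
    refine ⟨min (rmin / 2) (min (3 * rmin / (4 * M₂ ^ 2 * θmax + 1)) (θmin / (2 * M₁ * ρmax + 1))),
      ?_, min_le_left _ _, (min_le_right _ _).trans (min_le_left _ _),
      (min_le_right _ _).trans (min_le_right _ _)⟩
    have : 0 < 4 * M₂ ^ 2 * θmax + 1 := by positivity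
    have : 0 < 2 * M₁ * ρmax + 1 := by nlinarith
    positivity
  obtain ⟨L, hL1, hLr, hLρ, hLϑ, hLθ, hLw, hLu⟩ : ∃ L : ℝ, 1 ≤ L ∧ rmax ≤ L ∧ ρmax ≤ L ∧ ϑmax ≤ L ∧
      θmax ≤ L ∧ wmax ≤ L ∧ umax ≤ L :=
    ⟨1 + rmax + ρmax + ϑmax + θmax + wmax + umax, by linarith, by linarith, by linarith, by linarith,
      by linarith, by linarith, by linarith⟩
  refine ⟨κ / (θmax + 1), by positivity, 1 + 2 * L ^ 2 + 48 * L ^ 4, by positivity, ?_⟩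
  intro τ hτ x V hV
  have hτT : τ ∈ Ico 0 T := htT hτ
  obtain ⟨hV1, hVp, hVE⟩ := hKΩ hV
  have hVθ := hθopos V hV
  have hρ0 := hE.density_pos τ hτT x
  have hθ0 := hE.temperature_pos τ hτT x
  -- abbreviations
  set r := V.1 with hr
  set w : V3 := V.1⁻¹ • V.2.1 with hw
  set ϑ := θo V with hϑ
  have hrle : r ≤ rmax := hrmax V hV
  have hrge : rmin ≤ r := hrmin V hV
  have hρle : ρ τ x ≤ ρmax := (le_abs_self _).trans (hρmax τ hτ x)
  have hρge : ρmin ≤ ρ τ x := hρmin τ hτ x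
  have hθle : θ τ x ≤ θmax := (le_abs_self _).trans (hθmax τ hτ x)
  have hθge : θmin ≤ θ τ x := hθmin τ hτ x
  have hϑle : ϑ ≤ ϑmax := hϑmax V hV
  have hϑge : ϑmin ≤ ϑ := hϑmin V hV
  have hwle : ‖w‖ ≤ wmax := hwmax V hV
  have hule : ‖u τ x‖ ≤ umax := humax τ hτ x
  constructor
  · -- coercivity
    rw [hrel_eq hE hσ hF hpack θo hθo h hh pair hpair hτT x hV1 hVp hVθ]
    have hT2 := thermal_lower (M₂ := M₂) hrge hrmin0 hθ0 hθge hθmin0 hθle hVθ hϑle hϑmax0 hM₂1 hM₂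
    have hT3 := density_lower (M₁ := M₁) hV1 hrle hrmax0 hρ0 hρge hρmin0 hρle hθ0 hθge hM₁1 hM₁
    have hT4 : 0 ≤ θ τ x * (r * F (r * σ ^ 3) - ρ τ x * F (ρ τ x * σ ^ 3) -
        (F (ρ τ x * σ ^ 3) + ρ τ x * σ ^ 3 * deriv F (ρ τ x * σ ^ 3)) * (r - ρ τ x)) :=
      mul_nonneg hθ0.le (bregman_nonneg hσ hFa hconv hV1 hVp hρ0 (hpack τ hτT x))
    have hT1 : rmin / 2 * ‖w - u τ x‖ ^ 2 ≤ 1 / 2 * r * ‖w - u τ x‖ ^ 2 := by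
      nlinarith [sq_nonneg ‖w - u τ x‖]
    have e2 := mul_le_mul_of_nonneg_right k2 (sq_nonneg (ϑ - θ τ x))
    have e3 := mul_le_mul_of_nonneg_right k3 (sq_nonneg (r - ρ τ x))
    have e1 := mul_le_mul_of_nonneg_right k1 (sq_nonneg ‖w - u τ x‖)
    have hsum : κ * ((r - ρ τ x) ^ 2 + ‖w - u τ x‖ ^ 2 + (ϑ - θ τ x) ^ 2) ≤
        1 / 2 * r * ‖w - u τ x‖ ^ 2 + 3 / 2 * r * θ τ x * ((ϑ / θ τ x - 1) - Real.log (ϑ / θ τ x)) +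
        θ τ x * ρ τ x * klFun (r / ρ τ x) +
        θ τ x * (r * F (r * σ ^ 3) - ρ τ x * F (ρ τ x * σ ^ 3) -
          (F (ρ τ x * σ ^ 3) + ρ τ x * σ ^ 3 * deriv F (ρ τ x * σ ^ 3)) * (r - ρ τ x)) := by
      linarith
    have hθinv : (θmax + 1)⁻¹ ≤ (θ τ x)⁻¹ := inv_anti₀ hθ0 (by linarith)
    have hS0 : 0 ≤ κ * ((r - ρ τ x) ^ 2 + ‖w - u τ x‖ ^ 2 + (ϑ - θ τ x) ^ 2) := by positivity
    calc κ / (θmax + 1) * ((r - ρ τ x) ^ 2 + ‖w - u τ x‖ ^ 2 + (ϑ - θ τ x) ^ 2)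
        = (θmax + 1)⁻¹ * (κ * ((r - ρ τ x) ^ 2 + ‖w - u τ x‖ ^ 2 + (ϑ - θ τ x) ^ 2)) := by ring
      _ ≤ (θ τ x)⁻¹ * (κ * ((r - ρ τ x) ^ 2 + ‖w - u τ x‖ ^ 2 + (ϑ - θ τ x) ^ 2)) :=
        mul_le_mul_of_nonneg_right hθinv hS0
      _ ≤ _ := mul_le_mul_of_nonneg_left hsum (inv_nonneg.2 hθ0.le)
  · -- the conservative distance
    have hdec := consVar_of_prim θo hθo hV1.ne'
    have hV2 : V.2.1 = r • w := by
      have := congrArg (fun W : ℝ × V3 × ℝ => W.2.1) hdec; simpa using this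
    have hV3 : V.2.2 = totalEnergyDensity r w ϑ := by
      have := congrArg (fun W : ℝ × V3 × ℝ => W.2.2) hdec; simpa using this
    have hrL : |r| ≤ L := by rw [abs_of_pos hV1]; linarith
    have hm2 := momentum_sq_le (w := w) (ρ := ρ τ x) hrL (hule.trans hLu)
    have he : |V.2.2 - totalEnergyDensity (ρ τ x) (u τ x) (θ τ x)| ≤
        4 * L ^ 2 * (|r - ρ τ x| + ‖w - u τ x‖ + |ϑ - θ τ x|) := by
      rw [hV3]
      simp only [totalEnergyDensity]
      refine abs_energy_sub_le (wn := ‖w‖) (un := ‖u τ x‖) ?_ ?_ (norm_nonneg _) (norm_nonneg _)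
        (hwle.trans hLw) (hule.trans hLu) (norm_nonneg (w - u τ x)) ?_ rfl rfl hL1
      · rw [abs_of_pos hρ0]; linarith
      · rw [abs_of_pos hVθ]; linarith
      · exact abs_norm_sub_norm_le _ _
    have he2 := energy_sq_le he
    rw [hV2]
    have n1 : 0 ≤ ‖w - u τ x‖ ^ 2 := sq_nonneg _
    have n2 : 0 ≤ (ϑ - θ τ x) ^ 2 := sq_nonneg _
    have n3 : 0 ≤ L ^ 2 * (ϑ - θ τ x) ^ 2 := mul_nonneg (sq_nonneg _) (sq_nonneg _)
    linarith [hm2, he2]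

end Solution

end Summit.AtomisticToContinuum.HydrodynamicLimit.Theorems.EntropicWeakStrong

end
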